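import Mathlib
import Summits.CriticalPhenomena.PercolationContinuityZ3.Theorems.PercBudgetLadderPinholeClosingShellExclusion
import HarnessLib

/-!
# Crux `PercBudgetLadder.PinholeClosing` (stmt-CriticalPhenomena-5249), line `budget-halving` (shell form) — merging pockets along charts

Helper file of lead `prover-line-stmt-CriticalPhenomena-5249-c3-0` for the reshaped skeleton
`Cruxes/PinholeClosing/Lines/budget_halving.lean`; proves the registered auxiliary stub `stub_chartMerge`
(`--supports stmt-CriticalPhenomena-5249`), the bookkeeping half of the registered stub `stub_shellMerge`.
Deterministic, tree vocabulary only (translates `(box 3 n).image (· + y)`, grid translates `u • z`,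
`PocketResampling.openBdry ω U` = number of open lattice boundary edges of `U`).

* `row_merge`, `face_merge`: submodularity of the open cut function (`ShellExclusion.openBdry_union_le`) merges
  pockets WITHOUT budget growth as long as each new pocket contains the floor box of its chart point and the
  previous union contains that floor box too; iterated along a row, then row by row.
* `image_smul_nest`, `chart_merge` / `stub_chartMerge`: for a chart `p : ℕ → ℕ → ℤ³` of grid points whose
  consecutive points (in `t`, and in `s` along `t = 0`) are sup-norm neighbours, the floor box `box u + u • p(s,t+1)`
  sits inside the source box `box n + u • p(s,t)` because `2u ≤ n`, so `face_merge` applies to the pockets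
  `U (p s t) ⊇ box n + u • p(s,t)`.
* `subset_chartUnion`, `grid_round`: membership of a pocket in the merged union; rounding a coordinate down to the
  grid `uℤ - Ru`.

Sources: folklore (submodularity of cut functions).
-/

noncomputable section

namespace Summit.CriticalPhenomena.PercolationContinuityZ3.Theorems

open MeasureTheory
open scoped Classical
open Literature.Probability.Percolation Literature.Probability.LatticeModels
open Summit.CriticalPhenomena.PercolationContinuityZ3.Theorems.PinholeClosing.Negative
open Summit.CriticalPhenomena.PercolationContinuityZ3.Theorems.PocketResampling (openBdry)

namespace ShellExclusion

/-! ## Merging pockets along a chart (abstract bookkeeping) -/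

/-- **Row merge.**  Pockets `U t` (`t < K`) with at most `j` open doors, floor boxes `Q t ⊆ U t` such that every
`X` with `Q t ⊆ X ⊆ U t` has at least `j` open doors, consecutive floor boxes nested in the previous pocket
(`Q (t+1) ⊆ U t`), and a base set with at most `j` open doors containing `Q 0`: then the union of the base and
the first `T` pockets has at most `j` open doors. -/
theorem row_merge {ω : BondConfig (Site 3)} {j K : ℕ} {U Q : ℕ → Finset (Site 3)}
    (hU : ∀ t < K, openBdry ω (U t) ≤ j) (hQU : ∀ t < K, Q t ⊆ U t)
    (hfl : ∀ t < K, ∀ X : Finset (Site 3), Q t ⊆ X → X ⊆ U t → j ≤ openBdry ω X)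
    (hstep : ∀ t, t + 1 < K → Q (t + 1) ⊆ U t)
    {Base : Finset (Site 3)} (hBase : openBdry ω Base ≤ j) (hBase0 : Q 0 ⊆ Base) :
    ∀ T ≤ K, openBdry ω (Base ∪ (Finset.range T).biUnion U) ≤ j := by
  intro T
  induction T with
  | zero => intro _; simpa using hBase
  | succ T ih =>
    intro hT
    have ih' := ih (by omega)
    have hTK : T < K := by omega
    rw [Finset.range_add_one, Finset.biUnion_insert, Finset.union_comm (U T), ← Finset.union_assoc]
    refine openBdry_union_le ih' (hU T hTK) (hfl T hTK _ ?_ Finset.inter_subset_right)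
    refine Finset.subset_inter ?_ (hQU T hTK)
    cases T with
    | zero => exact hBase0.trans Finset.subset_union_left
    | succ T' =>
      refine (hstep T' (by omega)).trans ?_
      exact (Finset.subset_biUnion_of_mem U (Finset.mem_range.2 (Nat.lt_succ_self T'))).trans
        Finset.subset_union_right

/-- **Face merge.**  The two-dimensional version of `row_merge`: pockets `U s t` and floor boxes `Q s t`
(`s, t < K`) as there, nested along `t` inside each row and along `s` between the row heads
(`Q (s+1) 0 ⊆ U s 0`), and a previous set with at most `j` open doors containing `Q 0 0`: the union of the
previous set and the first `S` rows has at most `j` open doors. -/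
theorem face_merge {ω : BondConfig (Site 3)} {j K : ℕ} {U Q : ℕ → ℕ → Finset (Site 3)}
    (hU : ∀ s < K, ∀ t < K, openBdry ω (U s t) ≤ j) (hQU : ∀ s < K, ∀ t < K, Q s t ⊆ U s t)
    (hfl : ∀ s < K, ∀ t < K, ∀ X : Finset (Site 3), Q s t ⊆ X → X ⊆ U s t → j ≤ openBdry ω X)
    (hstep_t : ∀ s < K, ∀ t, t + 1 < K → Q s (t + 1) ⊆ U s t)
    (hstep_s : ∀ s, s + 1 < K → Q (s + 1) 0 ⊆ U s 0)
    {Prev : Finset (Site 3)} (hPrev : openBdry ω Prev ≤ j) (hPrev0 : Q 0 0 ⊆ Prev) :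
    ∀ S ≤ K, openBdry ω (Prev ∪ (Finset.range S).biUnion (fun s => (Finset.range K).biUnion (U s))) ≤ j := by
  intro S
  induction S with
  | zero => intro _; simpa using hPrev
  | succ S ih =>
    intro hS
    have ih' := ih (by omega)
    have hSK : S < K := by omega
    rw [Finset.range_add_one, Finset.biUnion_insert, Finset.union_comm ((Finset.range K).biUnion (U S)),
      ← Finset.union_assoc]
    refine row_merge (hU S hSK) (hQU S hSK) (hfl S hSK) (hstep_t S hSK) ih' ?_ K le_rfl
    cases S with
    | zero => exact hPrev0.trans Finset.subset_union_left
    | succ S' =>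
      refine (hstep_s S' (by omega)).trans ?_
      intro v hv
      refine Finset.mem_union_right _ (Finset.mem_biUnion.2 ⟨S', Finset.mem_range.2 (Nat.lt_succ_self S'), ?_⟩)
      exact Finset.mem_biUnion.2 ⟨0, Finset.mem_range.2 (by omega), hv⟩

/-- Floor boxes follow the chart: if two grid points `a, b ∈ ℤ³` are sup-norm neighbours (or equal) and `2u ≤ n`,
then `box u + u • a ⊆ box n + u • b`. -/
theorem image_smul_nest {n u : ℕ} (h2u : 2 * u ≤ n) {a b : Site 3} (hab : ∀ i, |a i - b i| ≤ 1) :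
    (box 3 u).image (· + (u : ℤ) • a) ⊆ (box 3 n).image (· + (u : ℤ) • b) := by
  refine image_add_box_subset_image_add_box fun i => ?_
  have hu0 : (0 : ℤ) ≤ u := by positivity
  have h1 : (u : ℤ) * |a i - b i| ≤ u * 1 := mul_le_mul_of_nonneg_left (hab i) hu0
  have h2 : (2 * u : ℕ) ≤ (n : ℤ) := by exact_mod_cast h2u
  simp only [Pi.smul_apply, smul_eq_mul]
  rw [← mul_sub, abs_mul, abs_of_nonneg hu0]
  push_cast at h2
  linarith

/-- **Chart merge.**  Pockets `U z` indexed by grid points, a chart `p : ℕ → ℕ → ℤ³` whose consecutive points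
(in `t`, and in `s` along `t = 0`) are sup-norm neighbours, pockets with `≤ j` open doors containing the source
boxes `box n + u • p(s,t)` and bounding from below (`≥ j`) the open doors of every set between the floor box
`box u + u • p(s,t)` and the pocket: then the previous set (with `≤ j` open doors, containing the source box of
`p(0,0)`) merged with all the pockets of the chart still has `≤ j` open doors (`face_merge` + `image_smul_nest`). -/
theorem chart_merge {ω : BondConfig (Site 3)} {j K n u : ℕ} (U : Site 3 → Finset (Site 3)) (p : ℕ → ℕ → Site 3)
    (hUp : ∀ s < K, ∀ t < K, openBdry ω (U (p s t)) ≤ j)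
    (hQU : ∀ s < K, ∀ t < K, (box 3 n).image (· + (u : ℤ) • p s t) ⊆ U (p s t))
    (hfl : ∀ s < K, ∀ t < K, ∀ X : Finset (Site 3),
      (box 3 u).image (· + (u : ℤ) • p s t) ⊆ X → X ⊆ U (p s t) → j ≤ openBdry ω X)
    (hadj_t : ∀ s t, ∀ i, |p s (t + 1) i - p s t i| ≤ 1)
    (hadj_s : ∀ s, ∀ i, |p (s + 1) 0 i - p s 0 i| ≤ 1)
    (h2u : 2 * u ≤ n) {Prev : Finset (Site 3)} (hPrev : openBdry ω Prev ≤ j)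
    (hPrev0 : (box 3 n).image (· + (u : ℤ) • p 0 0) ⊆ Prev) :
    openBdry ω (Prev ∪ (Finset.range K).biUnion fun s => (Finset.range K).biUnion fun t => U (p s t)) ≤ j := by
  have hself : ∀ a : Site 3, ∀ i, |a i - a i| ≤ 1 := fun a i => by simp
  refine face_merge (K := K) (U := fun s t => U (p s t)) (Q := fun s t => (box 3 u).image (· + (u : ℤ) • p s t))
    hUp ?_ hfl ?_ ?_ hPrev ((image_smul_nest h2u (hself _)).trans hPrev0) K le_rfl
  · intro s hs t ht
    exact (image_smul_nest h2u (hself _)).trans (hQU s hs t ht)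
  · intro s hs t ht1
    exact (image_smul_nest h2u (hadj_t s t)).trans (hQU s hs t (by omega))
  · intro s hs1
    exact (image_smul_nest h2u (hadj_s s)).trans (hQU s (by omega) 0 (by omega))

/-- The pockets of a chart with `s, t < K` lie in the merged union. -/
theorem subset_chartUnion (U : Site 3 → Finset (Site 3)) (p : ℕ → ℕ → Site 3) {K s t : ℕ} (hs : s < K)
    (ht : t < K) :
    U (p s t) ⊆ (Finset.range K).biUnion fun s => (Finset.range K).biUnion fun t => U (p s t) := by
  intro v hv
  refine Finset.mem_biUnion.2 ⟨s, Finset.mem_range.2 hs, ?_⟩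
  exact Finset.mem_biUnion.2 ⟨t, Finset.mem_range.2 ht, hv⟩

/-- **Rounding down to the grid.**  A coordinate `y ∈ [-Ru, Ru]` (`u ≥ 1`) is within `[0, u)` above a grid value
`u s - R u` with `s ≤ 2R`. -/
theorem grid_round {u R : ℕ} (hu : 1 ≤ u) {y : ℤ} (hy1 : -((R * u : ℕ) : ℤ) ≤ y) (hy2 : y ≤ ((R * u : ℕ) : ℤ)) :
    ∃ s : ℕ, s ≤ 2 * R ∧ 0 ≤ y + R * u - u * s ∧ y + R * u - u * s < u := by
  have hu0 : (0 : ℤ) < u := by exact_mod_cast hu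
  set a : ℤ := y + R * u with ha
  have ha0 : 0 ≤ a := by push_cast at hy1; linarith
  have ha2 : a ≤ (2 * R : ℕ) * (u : ℤ) := by push_cast at hy2 ⊢; linarith
  refine ⟨(a / u).toNat, ?_, ?_, ?_⟩
  · have h1 : a / u ≤ (2 * R : ℕ) := Int.ediv_le_of_le_mul hu0 ha2
    have h2 : 0 ≤ a / u := Int.ediv_nonneg ha0 hu0.le
    omega
  · rw [Int.toNat_of_nonneg (Int.ediv_nonneg ha0 hu0.le)]
    have := Int.emod_add_mul_ediv a u
    have := Int.emod_nonneg a hu0.ne'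
    linarith
  · rw [Int.toNat_of_nonneg (Int.ediv_nonneg ha0 hu0.le)]
    have := Int.emod_add_mul_ediv a u
    have := Int.emod_lt_of_pos a hu0
    linarith

end ShellExclusion

open ShellExclusion in
/-- **Registered auxiliary stub `stub_chartMerge`** (line `budget-halving`, shell form): `ShellExclusion.chart_merge`
in the registered raw form (open boundary counts written out as `((edgeBoundary (zdGraph 3) ·).filter (· ∈ ω)).card`).
Pockets `U z` with `≤ j` open doors containing the source boxes `box n + u • p(s,t)` of a chart `p` with neighbouring
consecutive points, floors (`≥ j` open doors between the floor box `box u + u • p(s,t)` and the pocket), `2u ≤ n`, and a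
previous set with `≤ j` open doors containing the source box of `p(0,0)`: the merged union has `≤ j` open doors. -/
theorem stub_chartMerge :
    ∀ (j K n u : ℕ) (ω : BondConfig (Site 3)) (U : Site 3 → Finset (Site 3)) (p : ℕ → ℕ → Site 3)
      (Prev : Finset (Site 3)),
      (∀ s < K, ∀ t < K, ((edgeBoundary (zdGraph 3) (U (p s t))).filter (· ∈ ω)).card ≤ j) →
      (∀ s < K, ∀ t < K, (box 3 n).image (· + (u : ℤ) • p s t) ⊆ U (p s t)) →
      (∀ s < K, ∀ t < K, ∀ X : Finset (Site 3), (box 3 u).image (· + (u : ℤ) • p s t) ⊆ X → X ⊆ U (p s t) →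
        j ≤ ((edgeBoundary (zdGraph 3) X).filter (· ∈ ω)).card) →
      (∀ s t, ∀ i, |p s (t + 1) i - p s t i| ≤ 1) → (∀ s, ∀ i, |p (s + 1) 0 i - p s 0 i| ≤ 1) → 2 * u ≤ n →
      ((edgeBoundary (zdGraph 3) Prev).filter (· ∈ ω)).card ≤ j →
      (box 3 n).image (· + (u : ℤ) • p 0 0) ⊆ Prev →
      ((edgeBoundary (zdGraph 3)
        (Prev ∪ (Finset.range K).biUnion fun s => (Finset.range K).biUnion fun t => U (p s t))).filter
          (· ∈ ω)).card ≤ j :=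
  fun _ _ _ _ _ U p _ hUp hQU hfl hadj_t hadj_s h2u hPrev hPrev0 =>
    chart_merge U p hUp hQU hfl hadj_t hadj_s h2u hPrev hPrev0

end Summit.CriticalPhenomena.PercolationContinuityZ3.Theorems

end
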